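import Literature.NumberTheory.LFunctions.FeketePolyaKernelCertificatesBlock
import Literature.NumberTheory.LFunctions.FeketePolyaKernelSignTablesWide
import HarnessLib

/-!
# Fekete–Pólya block certificates for WEIGHTED value streams (engine v4, reweighted characters)

Topic `Literature/NumberTheory/LFunctions`; namespace `Literature.NumberTheory.LFunctions.FeketePolyaKernel`
(sequel of `FeketePolyaKernelCertificatesBlock.lean`, `FeketePolyaKernelSignTablesWide.lean`). Small
computable definitions and THEOREMS (no named fact, no `sorry`). The block walk of the previous file with the
initial digit bound `1` replaced by a parameter `D₀` (`walkD`, `blockCertD`, `walkD_spec`, `blockCertD_sound`) —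
so that the value stream may be any integer sequence `x = dp − dm` given by two packed WEIGHT tables with digits
`≤ D₀` — and the weight tables of the REWEIGHTED value streams `a(n) = Σ_{(d,c)} c·[d ∣ n]·v(n/d)` of the
Fekete–Pólya criterion with a positive Euler-type factor (`FeketePolyaReweighted.lean`): a dilation `n ↦ [d∣n]v(n/d)`
of a sign table is the SAME table built at digit width `b·d` over `N/d` slots (`kpack_dilate`), so
`rwTabs kind b ps N tw` is a sum of plain sign tables of the character at the widths `b·d` (`rwTabs_eq`).

## References

* H. L. Montgomery, R. C. Vaughan, *Multiplicative Number Theory I*, CUP 2007, §9.3 Thm 9.13, §11.2.1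
  Exercises 7–8. [MontgomeryVaughan2007]
* J. von zur Gathen, J. Gerhard, *Modern Computer Algebra*, 3rd ed., CUP 2013, §8.4. [GathenGerhard2013ModernComputerAlgebra]
-/

namespace Literature.NumberTheory.LFunctions

namespace FeketePolyaKernel

open Finset Literature.Analysis.Convolution FeketePolyaTable
open scoped NumberTheorySymbols

/-! ### The walk with a digit bound `D₀` -/

/-- A state list of constant entries. [folklore] -/
private theorem stList_const' {f : ℕ → ℤ} {c : ℤ} : ∀ (k₀ K' : ℕ), (∀ k, k₀ < k → k ≤ k₀ + K' → f k = c) →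
    stList f k₀ K' = List.replicate K' c
  | _, 0, _ => rfl
  | k₀, K' + 1, h => by
    rw [stList, List.replicate_succ, h (k₀ + 1) (by omega) (by omega),
      stList_const' (k₀ + 1) K' fun k hk hk' => h k (by omega) (by omega)]

/-- Membership in a state list. [folklore] -/
private theorem mem_stList' (f : ℕ → ℤ) : ∀ (k₀ K' k : ℕ), k₀ < k → k ≤ k₀ + K' → f k ∈ stList f k₀ K'
  | _, 0, k, h1, h2 => by omega
  | k₀, K' + 1, k, h1, h2 => by
    rw [stList, List.mem_cons]
    rcases Nat.eq_or_lt_of_le h1 with h | h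
    · exact Or.inl (by rw [show k = k₀ + 1 by omega])
    · exact Or.inr (mem_stList' f (k₀ + 1) K' k h (by omega))

/-- `stepAcc` advances a state list by one position: from `[F_k(n−1)]_k` and `F_{k₀}(n)` to `[F_k(n)]_k` when
`F_{k+1}(n) = F_{k+1}(n−1) + F_k(n)`. [folklore] -/
private theorem stepAcc_stList' (F : ℕ → ℕ → ℤ) (n : ℕ) (hF : ∀ k, F (k + 1) n = F (k + 1) (n - 1) + F k n) :
    ∀ (k₀ K' : ℕ), stepAcc (stList (fun k => F k (n - 1)) k₀ K') (F k₀ n) = stList (fun k => F k n) k₀ K'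
  | _, 0 => rfl
  | k₀, K' + 1 => by
    simp only [stList, stepAcc]
    rw [← hF k₀, stepAcc_stList' F n hF (k₀ + 1) K']


/-- **The walk with digit bound `D₀`** (the values may be any integers of absolute value `≤ D₀`, given as packed
plus/minus WEIGHT tables) over a segment of `len` slots whose packed plus/minus tables are `Tp, Tm` (lowest digit =
first slot), by BINARY SPLITTING of depth `e` (so that the leaves are blocks of `≈ len/2^e` slots and the total
size of the intermediate numerals is `O(len·b·e)`): a leaf runs `levels` + `blockOK` on its block, a node walks
the lower half then the upper half; `none` as soon as a block fails, else the state after the segment.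
[cite: MontgomeryVaughan2007, §11.2.1 Exercise 7 (f)] -/
def walkD (b D₀ : ℕ) : ℕ → ℕ → ℕ → ℕ → List ℤ → Option (List ℤ)
  | 0, len, Tp, Tm, st =>
    bif Nat.beq len 0 then some st else
    match levels b len (onesV b len) ((1 <<< (b * len)) - 1) st Tp Tm D₀ with
    | (st', UpK, UmK, DK) => bif blockOK b len UpK UmK DK then some st' else none
  | e + 1, len, Tp, Tm, st =>
    match walkD b D₀ e (len / 2) (Tp &&& ((1 <<< (b * (len / 2))) - 1)) (Tm &&& ((1 <<< (b * (len / 2))) - 1)) st with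
    | none => none
    | some st' => walkD b D₀ e (len - len / 2) (Tp >>> (b * (len / 2))) (Tm >>> (b * (len / 2))) st'

/-- **The certificate of order `K`** over `Q` slots from WEIGHT tables `T` with digits `≤ D₀` (splitting depth `e`): the walk
passes from the zero state and the final sums `S_1(Q), …, S_K(Q)` (one more step with the value `0` at `n = Q`)
are `≥ 0`. [cite: MontgomeryVaughan2007, §11.2.1 Exercise 7 (f)] -/
def blockCertD (b e K Q D₀ : ℕ) (T : ℕ × ℕ) : Bool :=
  match walkD b D₀ e Q T.1 T.2 (List.replicate K 0) with
  | none => false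
  | some st => (stepAcc st 0).all fun s => decide (0 ≤ s)


/-! ### Soundness of the weighted walk -/

/-- **Invariant of the walk**: on the packed tables of the slots `pos, …, pos + len − 1` and the state
`[S_k(pos − 1)]_k`, a successful walk returns `[S_k(pos + len − 1)]_{1 ≤ k ≤ K}` and certifies `S_K(n) ≥ 0` for
`pos ≤ n < pos + len`. [cite: MontgomeryVaughan2007, §11.2.1 Exercise 7 (f)] -/
theorem walkD_spec {b K D₀ : ℕ} (hb : 2 ≤ b) (hD : D₀ < 2 ^ b) {x : ℕ → ℤ} (hx0 : x 0 = 0) {dp dm : ℕ → ℕ}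
    (hdp : ∀ n, dp n ≤ D₀) (hdm : ∀ n, dm n ≤ D₀) (hx : ∀ n, (dp n : ℤ) - dm n = x n) :
    ∀ (e len pos : ℕ) (st : List ℤ),
    walkD b D₀ e len (kpack b len fun i => dp (pos + i)) (kpack b len fun i => dm (pos + i))
      (stList (fun k => itS x k (pos - 1)) 0 K) = some st →
    st = stList (fun k => itS x k (pos + len - 1)) 0 K ∧ ∀ n, pos ≤ n → n < pos + len → 0 ≤ itS x K n := by
  have hb1 : 1 ≤ b := by omega
  have h1b : D₀ < 2 ^ b := hD
  intro e
  induction e with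
  | zero =>
    intro len pos st h
    rw [walkD] at h
    simp only [Nat.one_shiftLeft] at h
    by_cases hlen : len = 0
    · subst hlen
      simp only [show Nat.beq 0 0 = true from rfl, cond_true, Option.some.injEq] at h
      exact ⟨by rw [← h, Nat.add_zero], fun n hn hn' => by omega⟩
    have hbeq : Nat.beq len 0 = false := by
      cases hq : Nat.beq len 0
      · rfl
      · exact absurd (Nat.eq_of_beq_eq_true hq) hlen
    simp only [hbeq, cond_false] at h
    have hL1 : 1 ≤ len := Nat.one_le_iff_ne_zero.mpr hlen
    rcases hres : levels b len (onesV b len) (2 ^ (b * len) - 1) (stList (fun k => itS x k (pos - 1)) 0 K)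
        (kpack b len fun i => dp (pos + i)) (kpack b len fun i => dm (pos + i)) D₀ with ⟨st', UpK, UmK, DK⟩
    rw [hres] at h
    simp only at h
    cases hok : blockOK b len UpK UmK DK
    · simp [hok] at h
    simp only [hok, cond_true, Option.some.injEq] at h
    have hDK : DK < 2 ^ (b - 1) := blockOK_lt hok
    have hspec := levels_spec hb hL1 hx0 pos K 0 (kpack b len fun i => dp (pos + i))
      (kpack b len fun i => dm (pos + i)) D₀ (fun i => dp (pos + i)) (fun i => dm (pos + i)) rfl rfl
      (fun j _ => hdp _) (fun j _ => hdm _) (fun j _ => by rw [hx]; rfl)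
    rw [hres] at hspec
    obtain ⟨hst', f, g, hf, hg, hfD, hgD, hfg⟩ := hspec hDK
    simp only at hst' hf hg hfD hgD
    simp only [zero_add] at hfg
    have hle := blockOK_le hb hf hg hfD hgD hok
    refine ⟨by rw [← h, hst'], fun n hn hn' => ?_⟩
    obtain ⟨j, rfl⟩ : ∃ j, n = pos + j := ⟨n - pos, by omega⟩
    have hj : j < len := by omega
    have := hfg j hj
    have := hle j hj
    omega
  | succ e ih =>
    intro len pos st h
    rw [walkD] at h
    simp only [Nat.one_shiftLeft] at h
    have hle : len / 2 ≤ len := Nat.div_le_self len 2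
    obtain ⟨r, hr⟩ : ∃ r, len = len / 2 + r := ⟨len - len / 2, by omega⟩
    have hlowp : (kpack b len fun i => dp (pos + i)) &&& (2 ^ (b * (len / 2)) - 1) =
        kpack b (len / 2) fun i => dp (pos + i) :=
      kpack_land_low hle fun j _ => lt_of_le_of_lt (hdp _) h1b
    have hlowm : (kpack b len fun i => dm (pos + i)) &&& (2 ^ (b * (len / 2)) - 1) =
        kpack b (len / 2) fun i => dm (pos + i) :=
      kpack_land_low hle fun j _ => lt_of_le_of_lt (hdm _) h1b
    have hhighp : (kpack b len fun i => dp (pos + i)) >>> (b * (len / 2)) =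
        kpack b (len - len / 2) fun i => dp (pos + len / 2 + i) := by
      rw [show (kpack b len fun i => dp (pos + i)) = kpack b (len / 2 + r) fun i => dp (pos + i) from by rw [← hr],
        kpack_shiftRight_high fun j _ => lt_of_le_of_lt (hdp _) h1b, show len - len / 2 = r by omega]
      exact kpack_congr fun i _ => by rw [add_assoc]
    have hhighm : (kpack b len fun i => dm (pos + i)) >>> (b * (len / 2)) =
        kpack b (len - len / 2) fun i => dm (pos + len / 2 + i) := by
      rw [show (kpack b len fun i => dm (pos + i)) = kpack b (len / 2 + r) fun i => dm (pos + i) from by rw [← hr],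
        kpack_shiftRight_high fun j _ => lt_of_le_of_lt (hdm _) h1b, show len - len / 2 = r by omega]
      exact kpack_congr fun i _ => by rw [add_assoc]
    rw [hlowp, hlowm, hhighp, hhighm] at h
    rcases hlow : walkD b D₀ e (len / 2) (kpack b (len / 2) fun i => dp (pos + i)) (kpack b (len / 2) fun i => dm (pos + i))
        (stList (fun k => itS x k (pos - 1)) 0 K) with _ | st₁
    · rw [hlow] at h; simp at h
    rw [hlow] at h
    simp only at h
    obtain ⟨hst₁, hpos₁⟩ := ih (len / 2) pos st₁ hlow
    rw [hst₁, show pos + len / 2 - 1 = (pos + len / 2) - 1 by omega] at h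
    obtain ⟨hst, hpos₂⟩ := ih (len - len / 2) (pos + len / 2) st h
    refine ⟨by rw [hst, show pos + len / 2 + (len - len / 2) - 1 = pos + len - 1 by omega], fun n hn hn' => ?_⟩
    by_cases hnl : n < pos + len / 2
    · exact hpos₁ n hn hnl
    · exact hpos₂ n (by omega) (by omega)

/-- **Soundness of the weighted block certificate** (abstract value stream). If `x = dp − dm` with
`dp, dm ≤ D₀ < 2^b`, `x 0 = x Q = 0`, `T = (kpack dp, kpack dm)` over `Q ≥ 1` slots, `b ≥ 2`, `K ≥ 1` and
`blockCertD b e K Q D₀ T`, then `S_K(n) ≥ 0` for all `n ≤ Q` and `S_j(Q) ≥ 0` for `1 ≤ j ≤ K`.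
[cite: MontgomeryVaughan2007, §11.2.1 Exercise 7 (f)] -/
theorem blockCertD_sound {b e K Q D₀ : ℕ} (hb : 2 ≤ b) (hD : D₀ < 2 ^ b) (hK : 1 ≤ K) (hQ : 1 ≤ Q)
    {x : ℕ → ℤ} (hx0 : x 0 = 0) (hxQ : x Q = 0) {dp dm : ℕ → ℕ} (hdp1 : ∀ n, dp n ≤ D₀)
    (hdm1 : ∀ n, dm n ≤ D₀) (hx : ∀ n, (dp n : ℤ) - dm n = x n) {T : ℕ × ℕ}
    (hT : T = (kpack b Q dp, kpack b Q dm)) (h : blockCertD b e K Q D₀ T = true) :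
    (∀ n, n ≤ Q → 0 ≤ itS x K n) ∧ (∀ j, 1 ≤ j → j ≤ K → 0 ≤ itS x j Q) := by
  obtain ⟨Tp, Tm⟩ := T
  simp only [Prod.mk.injEq] at hT
  obtain ⟨hTp, hTm⟩ := hT
  unfold blockCertD at h
  simp only at h
  have hinit : List.replicate K 0 = stList (fun k => itS x k (0 - 1)) 0 K :=
    (stList_const' 0 K fun k hk _ => by
      obtain ⟨k', rfl⟩ : ∃ k', k = k' + 1 := ⟨k - 1, by omega⟩
      exact itS_succ_zero x k').symm
  have hTp' : Tp = kpack b Q fun i => dp (0 + i) := by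
    rw [hTp]; exact kpack_congr fun i _ => by rw [zero_add]
  have hTm' : Tm = kpack b Q fun i => dm (0 + i) := by
    rw [hTm]; exact kpack_congr fun i _ => by rw [zero_add]
  rw [hinit, hTp', hTm'] at h
  rcases hw : walkD b D₀ e Q (kpack b Q fun i => dp (0 + i)) (kpack b Q fun i => dm (0 + i))
      (stList (fun k => itS x k (0 - 1)) 0 K) with _ | st
  · rw [hw] at h; simp at h
  rw [hw] at h
  simp only [List.all_eq_true, decide_eq_true_eq] at h
  obtain ⟨hst, hpos⟩ := walkD_spec hb hD hx0 hdp1 hdm1 hx e Q 0 st hw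
  rw [zero_add] at hst
  -- the final sums `S_j(Q)`
  have hstep : stepAcc st 0 = stList (fun k => itS x k Q) 0 K := by
    rw [hst, show (0 : ℤ) = itS x 0 Q from hxQ.symm]
    exact stepAcc_stList' (itS x) Q (fun k => by
      obtain ⟨Q', rfl⟩ : ∃ Q', Q = Q' + 1 := ⟨Q - 1, by omega⟩
      rw [Nat.add_sub_cancel]; exact itS_succ_succ x k Q') 0 K
  rw [hstep] at h
  have hfin : ∀ j, 1 ≤ j → j ≤ K → 0 ≤ itS x j Q := fun j hj hjK =>
    h _ (mem_stList' (fun k => itS x k Q) 0 K j hj (by omega))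
  refine ⟨fun n hn => ?_, hfin⟩
  rcases Nat.lt_or_eq_of_le hn with hlt | rfl
  · exact hpos n (Nat.zero_le _) (by omega)
  · exact hfin K hK le_rfl


/-! ### Dilation of packed vectors and the weight tables of reweighted streams -/

/-- **Dilation is a change of digit width**: a packed vector at width `b·d` over `n` slots is the packed vector at
width `b` over `d·n` slots of the `d`-dilated digit function `s ↦ [d ∣ s]·f(s/d)` (`d ≥ 1`).
[cite: GathenGerhard2013ModernComputerAlgebra, §8.4 (Kronecker substitution)] -/
theorem kpack_dilate (b : ℕ) {d : ℕ} (hd : 1 ≤ d) (f : ℕ → ℕ) :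
    ∀ n : ℕ, kpack (b * d) n f = kpack b (d * n) fun s => if d ∣ s then f (s / d) else 0
  | 0 => by simp
  | n + 1 => by
    rw [kpack_succ, kpack_dilate b hd f n, show d * (n + 1) = d * n + d by ring, kpack_add,
      show b * (d * n) = b * d * n by ring, mul_comm (2 ^ (b * d * n))]
    congr 1
    obtain ⟨d', hd'⟩ : ∃ d', d = 1 + d' := ⟨d - 1, by omega⟩
    have hval : (kpack b d fun i => if d ∣ d * n + i then f ((d * n + i) / d) else 0) = f n := by
      have hsplit : kpack b (1 + d') (fun i => if d ∣ d * n + i then f ((d * n + i) / d) else 0) =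
          kpack b 1 fun _ => f n := by
        refine kpack_extend (fun j hj => ?_) (fun j hj1 hj2 => ?_)
        · have hj0 : j = 0 := by omega
          subst hj0
          rw [if_pos (by simp), add_zero, Nat.mul_div_cancel_left n (by omega)]
        · rw [if_neg]
          intro hdiv
          have h1 := (Nat.dvd_add_right (dvd_mul_right d n)).mp hdiv
          have h2 := Nat.le_of_dvd (by omega) h1
          omega
      rw [hd'] at hsplit ⊢
      rw [hsplit, kpack_one]
    rw [hval]

/-- **Weight tables of a reweighted stream**: for each `(d, c)` of `tw` (`c = ±1`) add the plain sign tables at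
width `b·d` (spreading chunk `min (b−1) 47`) over `N/d` slots — i.e. the tables of `n ↦ [d ∣ n]·v(n/d)` — to the
plus/minus weight tables according to the sign of `c`. [cite: MontgomeryVaughan2007, §11.2.1 Exercise 8] -/
def rwTabs (kind b : ℕ) (ps : List ℕ) (N : ℕ) : List (ℕ × ℤ) → ℕ × ℕ
  | [] => (0, 0)
  | (d, c) :: rest =>
    match rwTabs kind b ps N rest, plainTabsC kind (b * d) (min (b - 1) 47) ps (N / d) with
    | (Wp, Wm), (P, M) => if 0 < c then (Wp + P, Wm + M) else (Wp + M, Wm + P)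

/-- The reweighted INTEGER value stream `x(n) = Σ_{(d,c) ∈ tw} c·[d ∣ n]·v(n/d)`. [cite: MontgomeryVaughan2007, §11.2.1 Exercise 8] -/
def rwValZ (v : ℕ → ℤ) (tw : List (ℕ × ℤ)) (n : ℕ) : ℤ :=
  (tw.map fun dc => if dc.1 ∣ n then dc.2 * v (n / dc.1) else 0).sum

/-- Plus digits of the weight tables. [cite: MontgomeryVaughan2007, §11.2.1 Exercise 8] -/
def rwDp (v : ℕ → ℤ) : List (ℕ × ℤ) → ℕ → ℕ
  | [], _ => 0
  | (d, c) :: rest, n => rwDp v rest n +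
      (if d ∣ n then (if 0 < c then ind (v (n / d) = 1) else ind (v (n / d) = -1)) else 0)

/-- Minus digits of the weight tables. [cite: MontgomeryVaughan2007, §11.2.1 Exercise 8] -/
def rwDm (v : ℕ → ℤ) : List (ℕ × ℤ) → ℕ → ℕ
  | [], _ => 0
  | (d, c) :: rest, n => rwDm v rest n +
      (if d ∣ n then (if 0 < c then ind (v (n / d) = -1) else ind (v (n / d) = 1)) else 0)

/-- The digits are bounded by the number of terms. [cite: MontgomeryVaughan2007, §11.2.1 Exercise 8] -/
theorem rwDp_le (v : ℕ → ℤ) : ∀ (tw : List (ℕ × ℤ)) (n : ℕ), rwDp v tw n ≤ tw.length ∧ rwDm v tw n ≤ tw.length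
  | [], n => by simp [rwDp, rwDm]
  | (d, c) :: rest, n => by
    obtain ⟨h1, h2⟩ := rwDp_le v rest n
    simp only [rwDp, rwDm, List.length_cons]
    constructor <;> split_ifs <;> (try have := ind_le_one (v (n / d) = 1)) <;>
      (try have := ind_le_one (v (n / d) = -1)) <;> omega

/-- `plus − minus = value`: `rwDp − rwDm = rwValZ` when every `c` is `±1` and `v ∈ {0, ±1}`.
[cite: MontgomeryVaughan2007, §11.2.1 Exercise 8] -/
theorem rwDp_sub_rwDm {v : ℕ → ℤ} (hv : ∀ n, Val3 (v n)) :
    ∀ (tw : List (ℕ × ℤ)), (∀ dc ∈ tw, dc.2 = 1 ∨ dc.2 = -1) → ∀ n, (rwDp v tw n : ℤ) - rwDm v tw n = rwValZ v tw n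
  | [], _, n => by simp [rwDp, rwDm, rwValZ]
  | (d, c) :: rest, h, n => by
    have ih := rwDp_sub_rwDm hv rest (fun dc hdc => h dc (by simp [hdc])) n
    have hc : c = 1 ∨ c = -1 := h (d, c) (by simp)
    simp only [rwDp, rwDm, rwValZ, List.map_cons, List.sum_cons] at ih ⊢
    rw [← ih]
    by_cases hdn : d ∣ n
    · simp only [if_pos hdn]
      rcases hc with rfl | rfl <;> rcases hv (n / d) with h0 | h0 | h0 <;> simp [h0, ind] <;> ring
    · simp only [if_neg hdn]; push_cast; ring

/-- **The weight tables pack the plus/minus digits**: `rwTabs kind b ps N tw = (kpack b N (rwDp v tw),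
kpack b N (rwDm v tw))`, `v = plainVal kind (resTable ps)` (`b ≥ 2`; every `(d, c) ∈ tw` has `d ≥ 1`, `d ∣ N`,
and `p ∣ N/d` for all `p ∈ ps`, the pattern period divides `N/d`). [cite: MontgomeryVaughan2007, §11.2.1 Exercise 8] -/
theorem rwTabs_eq {kind b N : ℕ} (hb : 2 ≤ b) (ps : List ℕ) (hps1 : ∀ p ∈ ps, 1 ≤ p) :
    ∀ tw : List (ℕ × ℤ), (∀ dc ∈ tw, 1 ≤ dc.1 ∧ dc.1 ∣ N ∧ (∀ p ∈ ps, p ∣ N / dc.1) ∧ kindPeriod kind ∣ N / dc.1) →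
    rwTabs kind b ps N tw =
      (kpack b N (rwDp (plainVal kind (resTable ps)) tw), kpack b N (rwDm (plainVal kind (resTable ps)) tw))
  | [], _ => by
    simp only [rwTabs, Prod.mk.injEq]
    constructor <;> exact (kpack_zero_fun b N).symm.trans (kpack_congr fun n _ => by simp [rwDp, rwDm])
  | (d, c) :: rest, h => by
    obtain ⟨hd1, hdN, hpsd, h8⟩ := h (d, c) (by simp)
    have ih := rwTabs_eq (kind := kind) hb ps hps1 rest fun dc hdc => h dc (by simp [hdc])
    have hbd : 2 ≤ b * d := le_trans hb (Nat.le_mul_of_pos_right b hd1)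
    have hc1 : 1 ≤ min (b - 1) 47 := le_min (by omega) (by norm_num)
    have hc2 : min (b - 1) 47 ≤ b * d - 1 :=
      le_trans (min_le_left _ _) (Nat.sub_le_sub_right (Nat.le_mul_of_pos_right b hd1) 1)
    have hst := isSignTab_plainTabsC (kind := kind) hbd hc1 hc2 ps (fun p hp => ⟨hps1 p hp, hpsd p hp⟩) h8
    rcases hPM : plainTabsC kind (b * d) (min (b - 1) 47) ps (N / d) with ⟨P, M⟩
    rw [hPM] at hst
    obtain ⟨hP, hM⟩ := hst
    simp only at hP hM
    have hdil : ∀ (g : ℕ → ℕ), kpack (b * d) (N / d) g = kpack b N fun s => if d ∣ s then g (s / d) else 0 :=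
      fun g => by rw [kpack_dilate b hd1 g, Nat.mul_div_cancel' hdN]
    rw [hdil] at hP hM
    rw [rwTabs, ih, hPM]
    simp only
    split_ifs with hc
    · simp only [Prod.mk.injEq, hP, hM, kpack_add_kpack]
      constructor <;> exact kpack_congr fun n _ => by simp only [rwDp, rwDm, if_pos hc]
    · simp only [Prod.mk.injEq, hP, hM, kpack_add_kpack]
      constructor <;> exact kpack_congr fun n _ => by simp only [rwDp, rwDm, if_neg hc]

end FeketePolyaKernel

end Literature.NumberTheory.LFunctions
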